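import Summits.Ventures.HSemireg.FormulaNPinchN4

/-!
# Venture HSemireg — the TARGETS of the semiregularity maps `τ_k` on an abelian FOURFOLD (g = 8): the COUNT BARRIERS
# `dim ⊕_q H^{q,q+k}(A) = C(8, 4−k) = 70 ∕ 56 ∕ 28 ∕ 8 ∕ 1` on the carrier («needs e₁ ≤ 56», «needs e₂ ≤ 28»), and the (Σ5) DUALITY
# «`τ_k` injective ⟺ `ev_{n−k}` onto» DERIVED from `HT`-linearity of `σ` + the two trace (Serre) pairings, by value

HONEST FRAMING. Part of the Lean index of the computation cell `pub-hsemireg` (seat p9 gen 2, Sunday typer § g = 8; companion of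
`FormulaNPinchN4.lean` §3 and of the census files `CensusG8Table.lean` ∕ `CensusG8Verdict.lean`).  A DIMENSION COUNT read off the
tree's Hodge numbers of a complex abelian variety (`HodgeModel.finrank_typePiece_eq_choose_mul_choose`, Lange 2023 Thm 1.1.21 (b))
plus rank–nullity: no sheaf, no `Ext` group and no semiregularity map is constructed; `E` below is ANY finite-dimensional `ℂ`-space
standing BY VALUE for `Ext^k(F,F)` (or its `G`-invariants) of an object on the fourfold.  Nothing here says that HC / HC_CM / HC_AV
holds; nothing here is a new case of anything; no Literature fact is declared.

WHAT THE CENSUS SAYS (target-g8/CENSUS.md v1.273 `8eb43b237c4e60ad`, row B19-19 THEOREM (B-XVI), t-19 g5): «(a) F_x ⊠ F_y on E⁸ = E⁴_x ×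
E⁴_y is semiregular iff both factors are semiregular on E⁴ (needs e₂ ≤ 28) with injective T¹ (needs e₁ ≤ 56)»; row B19-24 THEOREM
(B-XXII): «e₂(G_i) ≥ χ + 14 = 46 ∕ 110 > 28 = dim ⊕_q H^{q+2}(Ω^q) ⇒ σ not injective»; t-8 g7 on design LT12-8-Z12-1 (bus l.10594, ×1,
numbers NOT typed here): «NOT G-semiregular — … by COUNT alone e₂^G = 266 > 28 = dim ⊕_q H^{q+2}(E⁴,Ω^q) ≥ rank τ₂».  The degree-`k`
Buchweitz–Flenner map `τ_k : Ext^k(F,F) → ⊕_q H^{q+k}(X, Ω^q_X)` on an abelian FOURFOLD `X` has, by Dolbeault `H^{p,q} ≅ H^q(Ω^p)`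
[Lange 2023, Thm 1.1.21 (a)], target `⊕_q H^{q,q+k}(X)` of dimension `Σ_q C(4,q)·C(4,q+k) = C(8, 4−k)` (Vandermonde): `70, 56, 28, 8, 1`
for `k = 0, 1, 2, 3, 4`.  `FormulaNPinchN4.lean` §3 typed the degree-2 target (`DolbeaultTargetTwo`, `28`); this file adds degrees 1
and 3 on the same carrier and the table.

CONTENT (all PROVED, 0 sorry; namespace `Summit.Ventures.HSemireg.FormulaN.PinchN4`, extending §3 of the companion file):
`hodgeTargetCount k := Σ_{q ≤ 4} C(4,q)·C(4,q+k)` with `hodgeTargetCount_table = [70, 56, 28, 8, 1]` and `= C(8, 4−k)`;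
`DolbeaultTargetOne A B = H^{0,1} × H^{1,2} × H^{2,3} × H^{3,4}` (type pieces of `H¹, H³, H⁵, H⁷(A(ℂ); ℂ)`), `finrank_dolbeaultTargetOne = 56`
for `A.dim = 4`; `DolbeaultTargetThree A B = H^{0,3} × H^{1,4}`, `finrank_dolbeaultTargetThree = 8`; the barriers
`finrank_le_finrank_ker_add_56` («needs e₁ ≤ 56» for `τ₁` injective) and `finrank_le_finrank_ker_add_8` (degree 3).  Degree 2 is
`finrank_le_finrank_ker_add_28` of the companion file.
§Σ5 (the companion's `injective_iff_surjective_of_transpose` took the TRANSPOSE IDENTITY as data; here it is DERIVED from structure,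
= s0-3 step0/C/NOGO-n4.md §2 (S2) «⟨σ^k(e), θ⟩ = Tr(e ∘ ob^{n−k}(θ)) (contraction acts on the form slot, Tr on the End slot: they
commute)» = th-7 FORMULA-N-th7 §C.2): BY VALUE, in three degrees `k`, `l = n − k`, `n`: the Yoneda product `mulE : E^l × E^k → E^n`,
the action `act : HT^l × T^k → T^n` of polyvector fields on the Dolbeault targets, `ev : HT^l → E^l` (`θ ↦ θ · id_F`, the
Atiyah-class ∕ HKR evaluation), `σ_k`, `σ_n`, and the traces `trE : E^n = Ext^n(F,F) → H^n(𝒪) = K`, `trT : T^n → H^n(𝒪) = K`;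
HYPOTHESES: `hlin` — `σ_n(ev θ · α) = θ ⋆ σ_k(α)` (`HT`-LINEARITY of `σ`: [BuchweitzFlenner2008HH] §6.3 Prop. 6.3.1 with [CRVdB 2012 =
Calaque–Rossi–Van den Bergh, Ann. of Math. 176, Thm 1.3], as cited in STRUCTURE §1 C19); `htr` — `trT ∘ σ_n = trE` (the `Ω⁰`-component of
`σ` is the trace, [BuchweitzFlenner2003] Def. of `σ` as `tr(exp(−At) ∘ ·)`); SERRE DUALITY by value — the pairing `⟨α, β⟩_E := trE(β · α)`
is perfect (`Bijective` as a map `E^k → (E^l)^*`; `ω_X ≅ 𝒪_X`, and for `G`-invariants `Ext_Y(F̄,F̄) = Ext_X(F,F)^G` on `Y = X∕G`) and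
`⟨t, θ⟩_T := trT(θ ⋆ t)` is left-separating (Serre duality `H^{q+k}(Ω^q)^∨ ≅ H^{l−q}(ΛqT)`).  RESULTS: `transpose_identity_of_linear_of_trace`
(`⟨σ_k α, θ⟩_T = ⟨α, ev θ⟩_E` — one line from `hlin`, `htr`), `injective_iff_surjective_of_pairings`, and **`sigma_injective_iff_ev_surjective`**
= (Σ5); at `n = 4`, `k = l = 2` this discharges the `duality` binder of the companion's `not_injective_tau_two`:
`not_injective_tau_two_of_linear_of_trace`.  NOT typed: that these by-value maps ARE the geometric ones (dictionary), HRR, the bridge (D4).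
-/

open Module LinearMap Function
open Literature.AlgebraicGeometry.HodgeTheory Literature.AlgebraicGeometry.Motives
open Finset.HasAntidiagonal (antidiagonal mem_antidiagonal)

namespace Summit.Ventures.HSemireg.FormulaN.PinchN4

/-! ## The Vandermonde row `C(8, 4 − k)` -/

/-- `Σ_{q=0}^{4} C(4,q)·C(4,q+k)`: the Hodge-number count of `⊕_q H^{q,q+k}` on an abelian FOURFOLD (summands with `q + k > 4`
vanish). -/
def hodgeTargetCount (k : ℕ) : ℕ := ∑ q ∈ Finset.range 5, Nat.choose 4 q * Nat.choose 4 (q + k)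

/-- the table `70, 56, 28, 8, 1` for `k = 0, …, 4` (and `0` beyond). -/
theorem hodgeTargetCount_table : (List.range 6).map hodgeTargetCount = [70, 56, 28, 8, 1, 0] := by decide

/-- … `= C(8, 4 − k)` for `k ≤ 4` (Vandermonde, checked on the five values). -/
theorem hodgeTargetCount_eq_choose {k : ℕ} (hk : k ≤ 4) : hodgeTargetCount k = Nat.choose 8 (4 - k) := by
  interval_cases k <;> decide

variable (A : AbelianVariety ℂ) (B : HodgeModel A.dim A.X)

/-- antidiagonal memberships of the type indices used below. -/
private lemma memAD (p q : ℕ) : ((p, q) : ℕ × ℕ) ∈ antidiagonal (p + q) := mem_antidiagonal.2 rfl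

/-! ## Degree 1: `H^{0,1} ⊕ H^{1,2} ⊕ H^{2,3} ⊕ H^{3,4}`, dimension `4 + 24 + 24 + 4 = 56` -/

/-- **The Dolbeault target of `τ₁` on a complex abelian variety `A`, on the carrier**: the Hodge pieces `H^{q,q+1}`, `q = 0..3`, of
`H¹, H³, H⁵, H⁷(A(ℂ); ℂ)` (= `⊕_q H^{q+1}(A, Ω^q)` by Dolbeault; for `dim A = 4` the summand `q = 4` vanishes). -/
abbrev DolbeaultTargetOne : Type :=
  (B.typePiece 1 ⟨(0, 1), memAD 0 1⟩) × (B.typePiece 3 ⟨(1, 2), memAD 1 2⟩) × (B.typePiece 5 ⟨(2, 3), memAD 2 3⟩) ×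
    (B.typePiece 7 ⟨(3, 4), memAD 3 4⟩)

/-- `Hᵏ(A(ℂ); ℂ)` is finite-dimensional (tree: `H• = ⋀•H¹`). -/
private lemma finite_complexBetti' (k : ℕ) : FiniteDimensional ℂ (complexBetti A.X k) :=
  abelianVarietyCohomologyExteriorH1.finite abelianVarietyCohomologyExteriorH1_holds A k

/-- the degree-1 target is finite-dimensional. -/
theorem finite_dolbeaultTargetOne : FiniteDimensional ℂ (DolbeaultTargetOne A B) := by
  haveI := finite_complexBetti' A; infer_instance

/-- **`dim (H^{0,1} ⊕ H^{1,2} ⊕ H^{2,3} ⊕ H^{3,4})(A) = 4 + 24 + 24 + 4 = 56` for a complex abelian FOURFOLD** (census B19-19 (a)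
«injective T¹ (needs e₁ ≤ 56)»). -/
theorem finrank_dolbeaultTargetOne (h4 : A.dim = 4) : finrank ℂ (DolbeaultTargetOne A B) = 56 := by
  haveI := finite_complexBetti' A
  rw [Module.finrank_prod, Module.finrank_prod, Module.finrank_prod, B.finrank_typePiece_eq_choose_mul_choose A,
    B.finrank_typePiece_eq_choose_mul_choose A, B.finrank_typePiece_eq_choose_mul_choose A,
    B.finrank_typePiece_eq_choose_mul_choose A, h4]
  decide

/-! ## Degree 3: `H^{0,3} ⊕ H^{1,4}`, dimension `4 + 4 = 8` -/

/-- **The Dolbeault target of `τ₃`**: the Hodge pieces `H^{0,3} ⊂ H³` and `H^{1,4} ⊂ H⁵` (for `dim A = 4`, `q ≥ 2` vanishes). -/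
abbrev DolbeaultTargetThree : Type :=
  (B.typePiece 3 ⟨(0, 3), memAD 0 3⟩) × (B.typePiece 5 ⟨(1, 4), memAD 1 4⟩)

/-- the degree-3 target is finite-dimensional. -/
theorem finite_dolbeaultTargetThree : FiniteDimensional ℂ (DolbeaultTargetThree A B) := by
  haveI := finite_complexBetti' A; infer_instance

/-- **`dim (H^{0,3} ⊕ H^{1,4})(A) = 4 + 4 = 8` for a complex abelian FOURFOLD** (t-8: «τ₃ 8∕104»). -/
theorem finrank_dolbeaultTargetThree (h4 : A.dim = 4) : finrank ℂ (DolbeaultTargetThree A B) = 8 := by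
  haveI := finite_complexBetti' A
  rw [Module.finrank_prod, B.finrank_typePiece_eq_choose_mul_choose A, B.finrank_typePiece_eq_choose_mul_choose A, h4]
  decide

/-! ## The barriers -/

variable {E : Type*} [AddCommGroup E] [Module ℂ E] [FiniteDimensional ℂ E]

/-- **COUNT BARRIER in degree 1** («needs e₁ ≤ 56»): any `ℂ`-linear `τ₁ : E → H^{0,1} ⊕ H^{1,2} ⊕ H^{2,3} ⊕ H^{3,4}(A)`, `A` a complex
abelian FOURFOLD, has `dim ker τ₁ ≥ dim E − 56`; `dim E > 56 ⇒ τ₁` not injective. -/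
theorem finrank_le_finrank_ker_add_56 (h4 : A.dim = 4) (τ : E →ₗ[ℂ] DolbeaultTargetOne A B) :
    finrank ℂ E ≤ finrank ℂ (ker τ) + 56 ∧ (56 < finrank ℂ E → ¬ Injective τ) := by
  haveI := finite_dolbeaultTargetOne A B
  refine ⟨?_, fun h => not_injective_of_lt_finrank τ ?_⟩
  · simpa only [finrank_dolbeaultTargetOne A B h4] using finrank_le_finrank_ker_add τ
  · simpa only [finrank_dolbeaultTargetOne A B h4] using h

/-- **COUNT BARRIER in degree 3**: any `ℂ`-linear `τ₃ : E → H^{0,3} ⊕ H^{1,4}(A)` has `dim ker τ₃ ≥ dim E − 8`. -/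
theorem finrank_le_finrank_ker_add_8 (h4 : A.dim = 4) (τ : E →ₗ[ℂ] DolbeaultTargetThree A B) :
    finrank ℂ E ≤ finrank ℂ (ker τ) + 8 ∧ (8 < finrank ℂ E → ¬ Injective τ) := by
  haveI := finite_dolbeaultTargetThree A B
  refine ⟨?_, fun h => not_injective_of_lt_finrank τ ?_⟩
  · simpa only [finrank_dolbeaultTargetThree A B h4] using finrank_le_finrank_ker_add τ
  · simpa only [finrank_dolbeaultTargetThree A B h4] using h

/-- The three barriers side by side: the target dimensions in degrees 1, 2, 3 on a complex abelian FOURFOLD are `56, 28, 8`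
(`= hodgeTargetCount 1, 2, 3`); degree 2 is the companion file's `finrank_dolbeaultTargetTwo`. -/
theorem dolbeaultTarget_dims (h4 : A.dim = 4) :
    finrank ℂ (DolbeaultTargetOne A B) = hodgeTargetCount 1 ∧ finrank ℂ (DolbeaultTargetTwo A B) = hodgeTargetCount 2 ∧
      finrank ℂ (DolbeaultTargetThree A B) = hodgeTargetCount 3 := by
  rw [finrank_dolbeaultTargetOne A B h4, finrank_dolbeaultTargetTwo A B h4, finrank_dolbeaultTargetThree A B h4]
  decide

/-! ## §Σ5. The duality «`τ_k` injective ⟺ `ev_{n−k}` onto» from `HT`-linearity and the trace pairings (s0-3 (S2), th-7 §C.2) -/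

section Sigma5

variable {K : Type*} [Field K]
variable {Ek El En Tk Tn Hl : Type*}
  [AddCommGroup Ek] [Module K Ek] [AddCommGroup El] [Module K El] [AddCommGroup En] [Module K En]
  [AddCommGroup Tk] [Module K Tk] [AddCommGroup Tn] [Module K Tn] [AddCommGroup Hl] [Module K Hl]

/-- **(Σ5) from two pairings**: if `⟨σ α, θ⟩_T = ⟨α, ev θ⟩_E` for a bilinear `⟨·,·⟩_E : E^k × E^l → K` that is BIJECTIVE as a map
`E^k → (E^l)^*` (Serre duality on `Ext`, by value) and a bilinear `⟨·,·⟩_T : T^k × HT^l → K` that is LEFT-SEPARATING (Serre duality on the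
Dolbeault side, by value), then `σ` is injective iff `ev` is onto (Mathlib `LinearMap.dualMap_injective_iff`). -/
theorem injective_iff_surjective_of_pairings (PE : Ek →ₗ[K] El →ₗ[K] K) (PT : Tk →ₗ[K] Hl →ₗ[K] K)
    (hPE : Bijective PE) (hPT : Injective PT) (σ : Ek →ₗ[K] Tk) (ev : Hl →ₗ[K] El)
    (adj : ∀ α θ, PT (σ α) θ = PE α (ev θ)) : Injective σ ↔ Surjective ev := by
  have key : PT ∘ₗ σ = ev.dualMap ∘ₗ PE := by
    ext α θ
    simp [adj]
  rw [← LinearMap.dualMap_injective_iff, ← hPT.of_comp_iff σ, ← Injective.of_comp_iff' ev.dualMap hPE]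
  change Injective (PT ∘ₗ σ) ↔ Injective (ev.dualMap ∘ₗ PE)
  rw [key]

/-- **The transpose identity from structure** (s0-3 NOGO-n4 (S2): «contraction acts on the form slot, Tr on the End slot: they
commute»): with the Yoneda product `mulE β α = β · α`, the action `act θ t = θ ⋆ t`, `ev θ = θ · id`, and the traces, `HT`-LINEARITY
`σ_n(ev θ · α) = θ ⋆ σ_k(α)` (`hlin`) and TRACE COMPATIBILITY `trT ∘ σ_n = trE` (`htr`) give `trT(θ ⋆ σ_k α) = trE(ev θ · α)`, i.e.
`⟨σ_k α, θ⟩_T = ⟨α, ev θ⟩_E` for the pairings `pairT`, `pairE` below. -/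
theorem transpose_identity_of_linear_of_trace (mulE : El →ₗ[K] Ek →ₗ[K] En) (act : Hl →ₗ[K] Tk →ₗ[K] Tn)
    (ev : Hl →ₗ[K] El) (σk : Ek →ₗ[K] Tk) (σn : En →ₗ[K] Tn) (trE : En →ₗ[K] K) (trT : Tn →ₗ[K] K)
    (hlin : ∀ θ α, σn (mulE (ev θ) α) = act θ (σk α)) (htr : trT ∘ₗ σn = trE) (α : Ek) (θ : Hl) :
    trT (act θ (σk α)) = trE (mulE (ev θ) α) := by
  rw [← hlin, ← htr]; rfl

/-- the Serre pairing on `Ext` built from the trace: `⟨α, β⟩_E = trE(β · α)` (`E^k × E^{n−k} → E^n → H^n(𝒪) = K`). -/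
def pairE (mulE : El →ₗ[K] Ek →ₗ[K] En) (trE : En →ₗ[K] K) : Ek →ₗ[K] El →ₗ[K] K :=
  LinearMap.mk₂ K (fun α β => trE (mulE β α)) (fun a b β => by simp) (fun c a β => by simp)
    (fun a β γ => by simp) (fun c a β => by simp)

/-- the Serre pairing on the Dolbeault side built from the action and the trace: `⟨t, θ⟩_T = trT(θ ⋆ t)`
(`⊕_q H^{q+k}(Ω^q) × HT^{n−k} → H^n(𝒪) = K`). -/
def pairT (act : Hl →ₗ[K] Tk →ₗ[K] Tn) (trT : Tn →ₗ[K] K) : Tk →ₗ[K] Hl →ₗ[K] K :=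
  LinearMap.mk₂ K (fun t θ => trT (act θ t)) (fun a b θ => by simp) (fun c a θ => by simp)
    (fun t θ θ' => by simp) (fun c t θ => by simp)

/-- **(Σ5) DERIVED** (th-7 FORMULA-N §C.2 «τ_k injective on (Ext^k)^G ⟺ ev_{n−k} : HT^{n−k}(X) ↠ (Ext^{n−k})^G», s0-3 NOGO-n4 (S2)):
`HT`-linearity of `σ` + trace compatibility + SERRE DUALITY BY VALUE (`pairE` bijective as `E^k → (E^{n−k})^*`, `pairT` left-separating)
⇒ `σ_k` injective ⟺ `ev_{n−k}` onto. -/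
theorem sigma_injective_iff_ev_surjective (mulE : El →ₗ[K] Ek →ₗ[K] En) (act : Hl →ₗ[K] Tk →ₗ[K] Tn)
    (ev : Hl →ₗ[K] El) (σk : Ek →ₗ[K] Tk) (σn : En →ₗ[K] Tn) (trE : En →ₗ[K] K) (trT : Tn →ₗ[K] K)
    (hlin : ∀ θ α, σn (mulE (ev θ) α) = act θ (σk α)) (htr : trT ∘ₗ σn = trE)
    (serreE : Bijective (pairE mulE trE)) (serreT : Injective (pairT act trT)) :
    Injective σk ↔ Surjective ev :=
  injective_iff_surjective_of_pairings (pairE mulE trE) (pairT act trT) serreE serreT σk ev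
    (fun α θ => transpose_identity_of_linear_of_trace mulE act ev σk σn trE trT hlin htr α θ)

/-- **NOGO-n4 with (Σ5) discharged from structure** (the companion's `not_injective_tau_two` at `n = 4`, `k = n − k = 2`, with its
`duality` binder replaced by `HT`-linearity + trace compatibility + Serre duality by value on `E₂ = (Ext²)^G`, `E₄ = (Ext⁴)^G`,
`T₂`, `T₄`): bridges of ranks `8` ∕ `12`, simplicity `e₀ ≤ 2` and (H1)∕(H2) by value ⇒ `τ₂` is NOT injective. -/
theorem not_injective_tau_two_of_linear_of_trace {HT1 HT2 E1 E2 E4 T1 T2 T4 : Type*}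
    [AddCommGroup HT1] [Module K HT1] [AddCommGroup HT2] [Module K HT2] [AddCommGroup E1] [Module K E1]
    [AddCommGroup E2] [Module K E2] [AddCommGroup E4] [Module K E4] [AddCommGroup T1] [Module K T1]
    [AddCommGroup T2] [Module K T2] [AddCommGroup T4] [Module K T4] [FiniteDimensional K E1] [FiniteDimensional K E2]
    (ev₁ : HT1 →ₗ[K] E1) (τ₁ : E1 →ₗ[K] T1) (c₁ : HT1 →ₗ[K] T1) (bridge₁ : τ₁ ∘ₗ ev₁ = c₁)
    (hc₁ : finrank K (range c₁) = 8)
    (ev₂ : HT2 →ₗ[K] E2) (τ₂ : E2 →ₗ[K] T2) (c₂ : HT2 →ₗ[K] T2) (bridge₂ : τ₂ ∘ₗ ev₂ = c₂)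
    (hc₂ : finrank K (range c₂) = 12)
    (mulE : E2 →ₗ[K] E2 →ₗ[K] E4) (act : HT2 →ₗ[K] T2 →ₗ[K] T4) (τ₄ : E4 →ₗ[K] T4) (trE : E4 →ₗ[K] K) (trT : T4 →ₗ[K] K)
    (hlin : ∀ θ α, τ₄ (mulE (ev₂ θ) α) = act θ (τ₂ α)) (htr : trT ∘ₗ τ₄ = trE)
    (serreE : Bijective (pairE mulE trE)) (serreT : Injective (pairT act trT))
    (e0 cardG : ℕ) (hG : 0 < cardG) (vv : ℤ) (sign_law : 0 < vv)
    (hrr : vv = cardG * (2 * (e0 : ℤ) - 2 * (finrank K E1 : ℤ) + (finrank K E2 : ℤ))) (simple : e0 ≤ 2) :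
    ¬ Injective τ₂ :=
  not_injective_tau_two ev₁ τ₁ c₁ bridge₁ hc₁ ev₂ τ₂ c₂ bridge₂ hc₂
    (fun h => (sigma_injective_iff_ev_surjective mulE act ev₂ τ₂ τ₄ trE trT hlin htr serreE serreT).mp h)
    e0 cardG hG vv sign_law hrr simple

end Sigma5

end Summit.Ventures.HSemireg.FormulaN.PinchN4
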